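import Literature.Geometry.Kaehler.ComplexTorusDivisorSingularLocusHessianKernel
import HarnessLib

/-!
# The vertex of the tangent cone: tangent directions of the equimultiple locus `{mult ≥ r}` at a point
# of multiplicity `r` lie in the vertex of `TC_x(D)` — the leading form is invariant under translation
# by them (Ciliberto–van der Geer, Remark 19, reduced form; all multiplicities)

[tag: lange-cav-complex-tori] [linked: HodgeConjecture (lit-hodgefound SKELETON §A2, row A2-191)]

Layer `Literature/Geometry/Kaehler`, namespaces `Literature.Geometry.Kaehler.SCV` (§1–§3) and
`Literature.Geometry.Kaehler.ComplexTorus` (§4); lane `lit-hodgefound` (Track 2 foundations library),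
skeleton seat `lit-hodgefound-skel-2` (generation 41), plan row A2-191 (the order-`r` version of A2-188
`ComplexTorusDivisorSingularLocusHessianKernel`, which is the case `r = 2`: there the vertex of the
tangent cone quadric is `Ker D²ϑ(v)`). Theorems only; no definition, no named fact.

Sources, VERBATIM. C. Ciliberto, G. van der Geer, *Andreotti–Mayer loci and the Schottky problem*, Doc.
Math. 13 (2008) [held `paper:arxiv-math_0701353`, chunk p0007]: "the Taylor expansion of `θ` has the form
`θ = Σ_{i=r}^∞ θ_i` […] The equation `θ_r = 0` defines a hypersurface `TC_ξ` of degree `r` in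
`ℙ^{g−1} = ℙ(T_{X,0})`, which is the tangent cone to `Θ_X` at `x`. We will denote by `Vert(TC_ξ)` the
vertex of `TC_ξ`, i.e., the subspace of `ℙ^{g−1}` which is the locus of points of multiplicity `r` of
`TC_ξ`. Note that it may be empty. In case `r = 2`, the tangent cone `TC_ξ` is the quadric `Q_ξ` […] and
`Vert(TC_ξ)` is its vertex `Π_ξ`."; Remark 19 (held numbering, chunk p0007 L141–145): "As a consequence,
just like in Proposition (kerQ), one sees that for `ξ = (X, Θ_X, x)` the Zariski tangent space to
`Sing^{(r)}(Θ_X)` at `x` is contained in `Vert(TC_ξ)`."; chunk p0009 L146–149: "the quadric `Q_{b,ξ}`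
is a cone with vertex containing the projectivized Zariski tangent space to `R` at `x`". G. Farkas,
S. Grushevsky, R. Salvati Manni, A. Verra (JEMS 16, 2014) [held `paper:galaxy-pdf-788537660`], Prop. 2.8,
proof (chunks p0011–p0012): "Differentiating (4) with respect to `t` […] `H(x₀) · v = 0`" (the case
`r = 2`). E. M. Chirka, *Complex Analytic Sets* (1989), §1.5 (p. 10): "`ord_a f = k` if all partial
derivatives of `f` at `a` up to order `k − 1` inclusive vanish"; §8.4 Prop. 1 (p. 84): the tangent cone of
`Z_f` at `a` is the zero cone of the initial homogeneous polynomial `(f)_μ`.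

Dictionary. `f` entire on `E`, `ord_v f = k + 1 = r`, leading form `(f)_r(w) = D^r f(v)(w, …, w)` (A2-180
`SCV.leadingForm`). A vector `w` is in the VERTEX of the tangent cone `{(f)_r = 0}` iff `(f)_r` is
invariant under translation by `w`, `(f)_r(u + w) = (f)_r(u)` for all `u` — equivalently (by polarization,
§1) `D^r f(v)(w, u_2, …, u_r) = 0` for all `u_i` ("the locus of points of multiplicity `r` of `TC_ξ`").
The "Zariski tangent space to `Sing^{(r)}`" is replaced by its reduced, curvilinear shadow: velocities
`z′(0)` of curve germs `z(t)` with `ord_{z(t)} f ≥ r` for `t` near `0`, and linear families `v + W` inside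
`{ord ≥ r}`. On `X = V/Λ`, `D = (ϑ)`: `Sing^{(r)}(D) = {x ∣ mult_x(D) ≥ r}` (A2-174), `mult_{π(u)}(D) =
ord_u ϑ` (A2-168).

## Contents

* §1 symmetric multilinear forms: `apply_eq_zero_of_apply_cons_eq_zero` (if `M(w, ·) = 0` then `M(m) = 0`
  whenever some `m_j = w`), **`apply_const_add_eq_of_apply_cons_eq_zero`** (then `M(u + w, …, u + w) =
  M(u, …, u)`: `w` is in the vertex of `{M(u,…,u) = 0}`).
* §2 entire functions: `fderiv_iteratedFDeriv_apply_eq_zero_of_eventually_comp` (if `D^k f` vanishes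
  along a curve germ through `v` with velocity `w` then `D(D^k f)(v)·w = 0`),
  **`iteratedFDeriv_succ_apply_cons_eq_zero_of_eventually_le_pointOrder`** (`ord ≥ k + 1` along the curve
  ⇒ `D^{k+1} f(v)(w, u) = 0`), `iteratedFDeriv_succ_apply_eq_zero_of_eventually_le_pointOrder` (any slot),
  **`leadingForm_add_eq_of_eventually_le_pointOrder`** (REMARK 19, curve form: `ord_v f = k + 1` and
  `ord_{z(t)} f ≥ k + 1` near `t = 0` ⇒ `(f)_{k+1}(u + c·z′(0)) = (f)_{k+1}(u)`),
  `leadingForm_eq_zero_of_eventually_le_pointOrder` (the vertex lies on the cone).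
* §3 linear families: **`leadingForm_add_eq_of_forall_mem`** (`v + W ⊆ {ord ≥ ord_v f}` ⇒ `W ⊆ Vert`),
  `ne_top_of_forall_mem` (such a `W` is a proper subspace: the vertex of a non-zero form is proper).
* §4 complex tori, `D = (ϑ)`, `x = π(v)`, `mult_x(D) = k + 1`:
  **`leadingForm_add_eq_of_curve_subset_setOf_le_divisorMultAt`** ("the Zariski tangent space to
  `Sing^{(r)}(Θ_X)` at `x` is contained in `Vert(TC_ξ)`", curve-germ form),
  **`leadingForm_add_eq_of_subtorusTranslate_subset_setOf_le_divisorMultAt`** (linear families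
  `π(v + W) ⊆ {mult ≥ r}`: `W ⊆ Vert(TC_x D)`), `submodule_ne_top_of_subtorusTranslate_subset`,
  `iteratedFDeriv_apply_eq_zero_of_curve_subset_setOf_le_divisorMultAt` (polar form: `D^rϑ(v)(z′(0), ·) = 0`).

## References

* [CilibertoVandergeer2008] C. Ciliberto, G. van der Geer, *Andreotti–Mayer loci and the Schottky
  problem*, Doc. Math. 13 (2008) 453–504, §(tangent cones of higher multiplicity) (chunk p0007: `TC_ξ`,
  `Vert(TC_ξ)`), Remark 19 (p0007 L141–145), p0009 L146–149.
* [FarkasGrushevskySalvatiManniVerra2014] G. Farkas, S. Grushevsky, R. Salvati Manni, A. Verra, JEMS 16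
  (2014), Prop. 2.8 with proof (chunks p0011–p0012).
* [Chirka1989] E. M. Chirka, *Complex Analytic Sets* (1989), §1.5 (p. 10), §8.4 Prop. 1 (p. 84).
* [Lange2023AbelianVarietiesComplex] H. Lange, *Abelian Varieties over the Complex Numbers* (2023),
  §2.3.4 (p. 105 L20).
-/

noncomputable section

open scoped Manifold Topology
open Set Function Module Filter

namespace Literature.Geometry.Kaehler

universe u

namespace SCV

variable {E : Type*} [NormedAddCommGroup E] [NormedSpace ℂ E]

/-! ### §1 The vertex of a symmetric multilinear form -/

/-- For a SYMMETRIC `(k+1)`-linear form `M`: if `M(w, u_1, …, u_k) = 0` for all `u`, then `M(m) = 0` for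
every argument `m` having `w` in some slot. [cite: CilibertoVandergeer2008, §(tangent cones), chunk p0007 ("polar quadrics […] obtained from `TC_ξ` by iterated operations of polarization")] -/
theorem apply_eq_zero_of_apply_cons_eq_zero {k : ℕ} (M : E [×(k + 1)]→L[ℂ] ℂ)
    (hM : ∀ (x : Fin (k + 1) → E) (σ : Equiv.Perm (Fin (k + 1))), M (x ∘ σ) = M x) {w : E}
    (hw : ∀ u : Fin k → E, M (Fin.cons w u) = 0) (m : Fin (k + 1) → E) (j : Fin (k + 1)) (hj : m j = w) :
    M m = 0 := by
  rw [← hM m (Equiv.swap 0 j), ← Fin.cons_self_tail (m ∘ Equiv.swap 0 j)]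
  have h0 : (m ∘ Equiv.swap 0 j) 0 = w := by
    rw [Function.comp_apply, Equiv.swap_apply_left, hj]
  rw [h0]
  exact hw _

/-- **`w` is in the VERTEX**: if `M(w, ·) = 0` (symmetric `M`) then `u ↦ M(u, …, u)` is invariant under
translation by `w`: `M(u + w, …, u + w) = M(u, …, u)` ("the locus of points of multiplicity `r` of
`TC_ξ`"). [cite: CilibertoVandergeer2008, §(tangent cones), chunk p0007 ("`Vert(TC_ξ)` the vertex of `TC_ξ`, i.e., […] the locus of points of multiplicity `r` of `TC_ξ`")] -/
theorem apply_const_add_eq_of_apply_cons_eq_zero {k : ℕ} (M : E [×(k + 1)]→L[ℂ] ℂ)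
    (hM : ∀ (x : Fin (k + 1) → E) (σ : Equiv.Perm (Fin (k + 1))), M (x ∘ σ) = M x) {w : E}
    (hw : ∀ u : Fin k → E, M (Fin.cons w u) = 0) (u : E) :
    M (fun _ => u + w) = M (fun _ => u) := by
  classical
  -- `m j` has `u` in the slots `< j` and `u + w` in the slots `≥ j`
  let m : ℕ → (Fin (k + 1) → E) := fun j i => if (i : ℕ) < j then u else u + w
  have hstep : ∀ j : ℕ, M (m (j + 1)) = M (m j) := by
    intro j
    by_cases hjk : j < k + 1
    · have hupd : m j = Function.update (m (j + 1)) ⟨j, hjk⟩ (u + w) := by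
        funext i
        by_cases hij : i = ⟨j, hjk⟩
        · subst hij
          simp [m]
        · rw [Function.update_of_ne hij]
          have hij' : (i : ℕ) ≠ j := fun h => hij (Fin.ext h)
          simp only [m]
          by_cases hlt : (i : ℕ) < j
          · rw [if_pos hlt, if_pos (Nat.lt_succ_of_lt hlt)]
          · rw [if_neg hlt, if_neg (by omega)]
      have hself : Function.update (m (j + 1)) ⟨j, hjk⟩ u = m (j + 1) := by
        rw [Function.update_eq_self_iff]
        simp [m]
      rw [hupd, M.map_update_add, hself,
        apply_eq_zero_of_apply_cons_eq_zero M hM hw _ ⟨j, hjk⟩ (Function.update_self ..), add_zero]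
    · have : m (j + 1) = m j := by
        funext i
        simp only [m]
        rw [if_pos (by omega), if_pos (by omega)]
      rw [this]
  have hall : ∀ j : ℕ, M (m j) = M (m 0) := by
    intro j
    induction j with
    | zero => rfl
    | succ j ih => rw [hstep, ih]
  have hm0 : m 0 = fun _ => u + w := funext fun i => if_neg (Nat.not_lt_zero _)
  have hmk : m (k + 1) = fun _ => u := funext fun i => if_pos i.2
  rw [← hm0, ← hmk]
  exact (hall (k + 1)).symm

/-! ### §2 Entire functions: equimultiple curve germs give vertex directions -/

/-- If `D^k f` vanishes along a curve germ `z(t)` through `v = z(0)` with velocity `w = z′(0)`, then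
`D(D^k f)(v) · w = 0` (chain rule, as in the case `k = 1` of A2-188).
[cite: FarkasGrushevskySalvatiManniVerra2014, Prop. 2.8, proof (chunks p0011–p0012: "Differentiating […] with respect to `t`")] -/
theorem fderiv_iteratedFDeriv_apply_eq_zero_of_eventually_comp {f : E → ℂ} (hf : Differentiable ℂ f)
    {z : ℂ → E} {v w : E} (hz : HasDerivAt z w 0) (hv : z 0 = v) {k : ℕ}
    (h0 : ∀ᶠ t in 𝓝 (0 : ℂ), iteratedFDeriv ℂ k f (z t) = 0) :
    fderiv ℂ (iteratedFDeriv ℂ k f) v w = 0 := by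
  have hd : Differentiable ℂ (iteratedFDeriv ℂ k f) :=
    (contDiff_of_differentiable hf (n := ⊤)).differentiable_iteratedFDeriv
      (WithTop.coe_lt_coe.2 (ENat.coe_lt_top k))
  have h1 : HasDerivAt (fun t => iteratedFDeriv ℂ k f (z t)) (fderiv ℂ (iteratedFDeriv ℂ k f) v w) 0 := by
    rw [← hv]
    exact (hd (z 0)).hasFDerivAt.comp_hasDerivAt 0 hz
  have h2 : HasDerivAt (fun t => iteratedFDeriv ℂ k f (z t)) (0 : E [×k]→L[ℂ] ℂ) 0 :=
    (hasDerivAt_const (0 : ℂ) (0 : E [×k]→L[ℂ] ℂ)).congr_of_eventuallyEq (h0.mono fun t ht => ht)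
  exact h1.unique h2

/-- **If `ord_{z(t)} f ≥ k + 1` along a curve germ with `z(0) = v`, `z′(0) = w`, then
`D^{k+1} f(v)(w, u_1, …, u_k) = 0`** for all `u` (the polar forms of `(f)_{k+1}` with respect to `w`
vanish). [cite: CilibertoVandergeer2008, Remark 19 (chunk p0007 L141–145)] [cite: Chirka1989, §1.5 (p. 10)] -/
theorem iteratedFDeriv_succ_apply_cons_eq_zero_of_eventually_le_pointOrder {f : E → ℂ}
    (hf : Differentiable ℂ f) {z : ℂ → E} {v w : E} (hz : HasDerivAt z w 0) (hv : z 0 = v) {k : ℕ}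
    (h : ∀ᶠ t in 𝓝 (0 : ℂ), ((k + 1 : ℕ) : ℕ∞) ≤ pointOrder f (z t)) (u : Fin k → E) :
    iteratedFDeriv ℂ (k + 1) f v (Fin.cons w u) = 0 := by
  have h0 : ∀ᶠ t in 𝓝 (0 : ℂ), iteratedFDeriv ℂ k f (z t) = 0 :=
    h.mono fun t ht => (natCast_le_pointOrder_iff_iteratedFDeriv_eq_zero hf).1 ht k (Nat.lt_succ_self k)
  rw [iteratedFDeriv_succ_apply_left, Fin.cons_zero, Fin.tail_cons,
    fderiv_iteratedFDeriv_apply_eq_zero_of_eventually_comp hf hz hv h0, _root_.zero_apply]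

/-- The same with `w` in ANY slot (symmetry of `D^{k+1} f(v)`, A2-174).
[cite: CilibertoVandergeer2008, Remark 19 (chunk p0007)] [cite: Chirka1989, A1.1 (symmetry of the Taylor coefficients)] -/
theorem iteratedFDeriv_succ_apply_eq_zero_of_eventually_le_pointOrder {f : E → ℂ} (hf : Differentiable ℂ f)
    {z : ℂ → E} {v w : E} (hz : HasDerivAt z w 0) (hv : z 0 = v) {k : ℕ}
    (h : ∀ᶠ t in 𝓝 (0 : ℂ), ((k + 1 : ℕ) : ℕ∞) ≤ pointOrder f (z t)) (m : Fin (k + 1) → E)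
    (j : Fin (k + 1)) (hj : m j = w) : iteratedFDeriv ℂ (k + 1) f v m = 0 :=
  apply_eq_zero_of_apply_cons_eq_zero _ (iteratedFDeriv_comp_perm_of_differentiable hf v)
    (iteratedFDeriv_succ_apply_cons_eq_zero_of_eventually_le_pointOrder hf hz hv h) m j hj

/-- **REMARK 19 (curve form): the velocity of an equimultiple curve germ lies in the vertex of the tangent
cone.** If `ord_v f = k + 1` and `ord_{z(t)} f ≥ k + 1` for `t` near `0` (`z(0) = v`, `z′(0) = w`),
then the leading form is invariant under translation by `ℂw`: `(f)_{k+1}(u + c·w) = (f)_{k+1}(u)`.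
[cite: CilibertoVandergeer2008, Remark 19 (chunk p0007 L141–145: "the Zariski tangent space to `Sing^{(r)}(Θ_X)` at `x` is contained in `Vert(TC_ξ)`")] [cite: Chirka1989, §8.4 Prop. 1 (p. 84)] -/
theorem leadingForm_add_eq_of_eventually_le_pointOrder {f : E → ℂ} (hf : Differentiable ℂ f)
    {z : ℂ → E} {v w : E} (hz : HasDerivAt z w 0) (hv : z 0 = v) {k : ℕ}
    (hk : pointOrder f v = ((k + 1 : ℕ) : ℕ∞))
    (h : ∀ᶠ t in 𝓝 (0 : ℂ), ((k + 1 : ℕ) : ℕ∞) ≤ pointOrder f (z t)) (u : E) (c : ℂ) :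
    leadingForm f v (u + c • w) = leadingForm f v u := by
  rw [leadingForm_of_pointOrder_eq hk, leadingForm_of_pointOrder_eq hk]
  refine apply_const_add_eq_of_apply_cons_eq_zero _ (iteratedFDeriv_comp_perm_of_differentiable hf v)
    (fun u' => ?_) u
  have hupd : (Fin.cons (c • w) u' : Fin (k + 1) → E) =
      Function.update (Fin.cons w u' : Fin (k + 1) → E) 0 (c • w) := by
    rw [Fin.update_cons_zero]
  rw [hupd, ContinuousMultilinearMap.map_update_smul, Fin.update_cons_zero,
    iteratedFDeriv_succ_apply_cons_eq_zero_of_eventually_le_pointOrder hf hz hv h u', smul_zero]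

/-- In particular the vertex lies ON the cone: `(f)_{k+1}(c·w) = 0` (take `u = 0`; `(f)_r(0) = 0` as
`r ≥ 1`). [cite: CilibertoVandergeer2008, Remark 19 (chunk p0007)] [cite: Chirka1989, §8.4 Prop. 1 (p. 84)] -/
theorem leadingForm_smul_eq_zero_of_eventually_le_pointOrder {f : E → ℂ} (hf : Differentiable ℂ f)
    {z : ℂ → E} {v w : E} (hz : HasDerivAt z w 0) (hv : z 0 = v) {k : ℕ}
    (hk : pointOrder f v = ((k + 1 : ℕ) : ℕ∞))
    (h : ∀ᶠ t in 𝓝 (0 : ℂ), ((k + 1 : ℕ) : ℕ∞) ≤ pointOrder f (z t)) (c : ℂ) :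
    leadingForm f v (c • w) = 0 := by
  have h0 := leadingForm_add_eq_of_eventually_le_pointOrder hf hz hv hk h 0 c
  rw [zero_add, leadingForm_of_pointOrder_eq hk, leadingForm_of_pointOrder_eq hk] at h0
  rw [leadingForm_of_pointOrder_eq hk, h0]
  exact (iteratedFDeriv ℂ (k + 1) f v).map_zero

/-! ### §3 Linear families inside `{ord ≥ ord_v f}` -/

/-- **A linear family `v + W ⊆ {ord ≥ ord_v f}` lies in the vertex of the tangent cone at `v`**: for
`w ∈ W`, `(f)_r(u + w) = (f)_r(u)` for all `u` (`r = ord_v f = k + 1`).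
[cite: CilibertoVandergeer2008, Remark 19 (chunk p0007 L141–145) and p0009 L146–149 ("a cone with vertex containing the projectivized Zariski tangent space to `R` at `x`")] -/
theorem leadingForm_add_eq_of_forall_mem {f : E → ℂ} (hf : Differentiable ℂ f) {v : E} {k : ℕ}
    (hk : pointOrder f v = ((k + 1 : ℕ) : ℕ∞)) (W : Submodule ℂ E)
    (hW : ∀ w ∈ W, ((k + 1 : ℕ) : ℕ∞) ≤ pointOrder f (v + w)) {w : E} (hw : w ∈ W) (u : E) :
    leadingForm f v (u + w) = leadingForm f v u := by
  have hz : HasDerivAt (fun t : ℂ => v + t • w) w 0 := by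
    simpa using ((hasDerivAt_id (0 : ℂ)).smul_const w).const_add v
  have h1 := leadingForm_add_eq_of_eventually_le_pointOrder hf hz (by simp) hk
    (Eventually.of_forall fun t => hW _ (W.smul_mem t hw)) u 1
  rwa [one_smul] at h1

/-- The polar forms vanish on a linear equimultiple family: `D^{k+1} f(v)(m) = 0` whenever some `m_j ∈ W`.
[cite: CilibertoVandergeer2008, Remark 19 (chunk p0007)] [cite: Chirka1989, §1.5 (p. 10)] -/
theorem iteratedFDeriv_succ_apply_eq_zero_of_forall_mem {f : E → ℂ} (hf : Differentiable ℂ f) {v : E}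
    {k : ℕ} (W : Submodule ℂ E) (hW : ∀ w ∈ W, ((k + 1 : ℕ) : ℕ∞) ≤ pointOrder f (v + w))
    (m : Fin (k + 1) → E) (j : Fin (k + 1)) (hj : m j ∈ W) : iteratedFDeriv ℂ (k + 1) f v m = 0 := by
  have hz : HasDerivAt (fun t : ℂ => v + t • m j) (m j) 0 := by
    simpa using ((hasDerivAt_id (0 : ℂ)).smul_const (m j)).const_add v
  exact iteratedFDeriv_succ_apply_eq_zero_of_eventually_le_pointOrder hf hz (by simp)
    (Eventually.of_forall fun t => hW _ (W.smul_mem t hj)) m j rfl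

/-- **Such a `W` is a PROPER subspace** (`f ≢ 0`): the vertex of the non-zero form `(f)_r` is not all of
`E` (otherwise `(f)_r` would be constant, `= (f)_r(0) = 0`). [cite: CilibertoVandergeer2008, §(tangent cones), chunk p0007 ("`θ_r` […] is not identically zero"; "Note that it may be empty")] [cite: Chirka1989, §1.5 Prop. 1 (p. 11)] -/
theorem ne_top_of_forall_mem {f : E → ℂ} (hf : Differentiable ℂ f) (hf0 : f ≠ 0) {v : E} {k : ℕ}
    (hk : pointOrder f v = ((k + 1 : ℕ) : ℕ∞)) (W : Submodule ℂ E)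
    (hW : ∀ w ∈ W, ((k + 1 : ℕ) : ℕ∞) ≤ pointOrder f (v + w)) : W ≠ ⊤ := by
  intro htop
  refine leadingForm_ne_zero hf hf0 v (funext fun u => ?_)
  have hv : f v = 0 := by
    have h1 : (1 : ℕ∞) ≤ pointOrder f v := by rw [hk]; exact_mod_cast Nat.succ_pos k
    exact (one_le_pointOrder_iff hf).1 h1
  have h := leadingForm_add_eq_of_forall_mem hf hk W hW (show u ∈ W from htop ▸ Submodule.mem_top) 0
  rw [zero_add, leadingForm_apply_zero hf hf0 hv] at h
  exact h

end SCV

/-! ### §4 Complex tori: the equimultiple locus `{mult ≥ r}` of `D = (ϑ)` -/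

namespace ComplexTorus

section Divisor

variable {ι : Type*} [Fintype ι] {E : Type u} [NormedAddCommGroup E] [InnerProductSpace ℂ E]
  [FiniteDimensional ℂ E] {Φ : (ι → ℝ) ≃L[ℝ] E} {d : ℕ} {n : ℕ} (e : Fin n ≃ ι) (h : 2 * d + 2 = n)
  {η : E [⋀^Fin 2]→L[ℝ] ℝ} {χ : (ι → ℤ) → ℂ}

include e h in
/-- **"The Zariski tangent space to `Sing^{(r)}(Θ_X)` at `x` is contained in `Vert(TC_ξ)`" (curve-germ
form) on `X = V/Λ`**: let `mult_x(D) = k + 1` at `x = π(v)` and let `z(t)` be a curve germ with `z(0) = v`,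
`z′(0) = w` and `mult_{π z(t)}(D) ≥ k + 1` for `t` near `0`. Then the leading form of `ϑ` at `v` (the
tangent cone `TC_x(D)`, A2-183 `exists_initialFormMap`) is invariant under translation by `ℂw`.
[cite: CilibertoVandergeer2008, Remark 19 (chunk p0007 L141–145)] [cite: Lange2023AbelianVarietiesComplex, §2.3.4 (p. 105 L20)] -/
theorem leadingForm_add_eq_of_curve_subset_setOf_le_divisorMultAt (hη : IsNSForm Φ η)
    (hχ : IsSemicharacter Φ η χ) {ϑ : E → ℂ} (hϑ : ϑ ∈ thetaFunctions Φ (canonicalFactor Φ η χ))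
    (hϑ0 : ϑ ≠ 0) {z : ℂ → E} {v w : E} (hz : HasDerivAt z w 0) (hv : z 0 = v) {k : ℕ}
    (hk : divisorMultAt Φ d (divisorChain Φ d ϑ) (cover Φ v) = ((k + 1 : ℕ) : ℕ∞))
    (hmult : ∀ᶠ t in 𝓝 (0 : ℂ), ((k + 1 : ℕ) : ℕ∞) ≤ divisorMultAt Φ d (divisorChain Φ d ϑ) (cover Φ (z t)))
    (u : E) (c : ℂ) : SCV.leadingForm ϑ v (u + c • w) = SCV.leadingForm ϑ v u := by
  rw [divisorMultAt_divisorChain_cover e h hη hχ hϑ hϑ0] at hk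
  refine SCV.leadingForm_add_eq_of_eventually_le_pointOrder (mem_thetaFunctions_iff.1 hϑ).1 hz hv hk
    (hmult.mono fun t ht => ?_) u c
  rwa [divisorMultAt_divisorChain_cover e h hη hχ hϑ hϑ0] at ht

include e h in
/-- Polar form: **`D^rϑ(v)(z′(0), u_2, …, u_r) = 0`** along an equimultiple curve germ (`r = k + 1`), in any
slot. [cite: CilibertoVandergeer2008, Remark 19 (chunk p0007) and §(tangent cones) ("polar quadrics […] obtained from `TC_ξ` by iterated operations of polarization")] -/
theorem iteratedFDeriv_apply_eq_zero_of_curve_subset_setOf_le_divisorMultAt (hη : IsNSForm Φ η)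
    (hχ : IsSemicharacter Φ η χ) {ϑ : E → ℂ} (hϑ : ϑ ∈ thetaFunctions Φ (canonicalFactor Φ η χ))
    (hϑ0 : ϑ ≠ 0) {z : ℂ → E} {v w : E} (hz : HasDerivAt z w 0) (hv : z 0 = v) {k : ℕ}
    (hmult : ∀ᶠ t in 𝓝 (0 : ℂ), ((k + 1 : ℕ) : ℕ∞) ≤ divisorMultAt Φ d (divisorChain Φ d ϑ) (cover Φ (z t)))
    (m : Fin (k + 1) → E) (j : Fin (k + 1)) (hj : m j = w) : iteratedFDeriv ℂ (k + 1) ϑ v m = 0 := by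
  refine SCV.iteratedFDeriv_succ_apply_eq_zero_of_eventually_le_pointOrder (mem_thetaFunctions_iff.1 hϑ).1
    hz hv (hmult.mono fun t ht => ?_) m j hj
  rwa [divisorMultAt_divisorChain_cover e h hη hχ hϑ hϑ0] at ht

include e h in
/-- **Linear families `π(v + W) ⊆ {mult ≥ r}` through a point of multiplicity `r`: `W ⊆ Vert(TC_x D)`** —
`(ϑ)_r(u + w) = (ϑ)_r(u)` for `w ∈ W`. [cite: CilibertoVandergeer2008, Remark 19 (chunk p0007 L141–145) and p0009 L146–149] [cite: Lange2023AbelianVarietiesComplex, §2.3.4 (p. 105 L20)] -/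
theorem leadingForm_add_eq_of_subtorusTranslate_subset_setOf_le_divisorMultAt (hη : IsNSForm Φ η)
    (hχ : IsSemicharacter Φ η χ) {ϑ : E → ℂ} (hϑ : ϑ ∈ thetaFunctions Φ (canonicalFactor Φ η χ))
    (hϑ0 : ϑ ≠ 0) {v : E} {k : ℕ} (hk : divisorMultAt Φ d (divisorChain Φ d ϑ) (cover Φ v) = ((k + 1 : ℕ) : ℕ∞))
    (W : Submodule ℂ E)
    (hW : ∀ w ∈ W, ((k + 1 : ℕ) : ℕ∞) ≤ divisorMultAt Φ d (divisorChain Φ d ϑ) (cover Φ (v + w)))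
    {w : E} (hw : w ∈ W) (u : E) : SCV.leadingForm ϑ v (u + w) = SCV.leadingForm ϑ v u := by
  rw [divisorMultAt_divisorChain_cover e h hη hχ hϑ hϑ0] at hk
  refine SCV.leadingForm_add_eq_of_forall_mem (mem_thetaFunctions_iff.1 hϑ).1 hk W (fun w' hw' => ?_) hw u
  have h' := hW w' hw'
  rwa [divisorMultAt_divisorChain_cover e h hη hχ hϑ hϑ0] at h'

include e h in
/-- Such a linear family is PROPER: `W ≠ ⊤` (`D ≠ 0`). [cite: CilibertoVandergeer2008, §(tangent cones), chunk p0007 ("`θ_r` […] is not identically zero")] -/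
theorem submodule_ne_top_of_subtorusTranslate_subset (hη : IsNSForm Φ η) (hχ : IsSemicharacter Φ η χ)
    {ϑ : E → ℂ} (hϑ : ϑ ∈ thetaFunctions Φ (canonicalFactor Φ η χ)) (hϑ0 : ϑ ≠ 0) {v : E} {k : ℕ}
    (hk : divisorMultAt Φ d (divisorChain Φ d ϑ) (cover Φ v) = ((k + 1 : ℕ) : ℕ∞)) (W : Submodule ℂ E)
    (hW : ∀ w ∈ W, ((k + 1 : ℕ) : ℕ∞) ≤ divisorMultAt Φ d (divisorChain Φ d ϑ) (cover Φ (v + w))) :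
    W ≠ ⊤ := by
  rw [divisorMultAt_divisorChain_cover e h hη hχ hϑ hϑ0] at hk
  refine SCV.ne_top_of_forall_mem (mem_thetaFunctions_iff.1 hϑ).1 hϑ0 hk W fun w' hw' => ?_
  have h' := hW w' hw'
  rwa [divisorMultAt_divisorChain_cover e h hη hχ hϑ hϑ0] at h'

end Divisor

end ComplexTorus

end Literature.Geometry.Kaehler
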